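import Literature.MathematicalPhysics.QuantumFieldTheory.Balaban1983to89.BalabanUVClass
import HarnessLib

/-!
# THE TYPED CLASS HAS lf-ROOM — BY KERNEL (D25-8 «lf-transplant», its `Mem`-step and dismissal check (i), as lemmas about `BalabanUVClass.Mem`)

Cell `ym3-torus` (YM ladder rung R3 = continuum `SU(2)` Yang–Mills on the three-torus — a RUNG, NOT d = 4, NOT infinite volume, NOT a mass
gap, NOT Clay).  Width seat `ym-ust-20520-w4` (gen 20); `--supports stmt-QuantumFields-20520 --as helper`, count-neutral, definition-free,
default heartbeats, route-free imports (`Literature…BalabanUVClass` + `HarnessLib`); no registry, binder or `Lines/` edit; the registered skeleton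
`Lines/semiclassical_s2beta.lean` v11.4 and its five stubs are untouched (0∕5, ★★OWNER RULING №36).

WHAT THIS IS.  Ideator `ym-r3-idea-1` g25's typing dossier D25-8 «lf-transplant» (`Cruxes/FluctuationComparisonRegPrIntL/Lines/lf_transplant.md`
v1.2; ★★OWNER RULING №54, RECORD 17dv «O1 v16 := UNDER REVIEW ∕ SUSPECT-MISSTATED») moves large-field mass onto fibres over a thin NON-LOCAL
two-plaquette bump of coarse window data and observes that every clause of the PATH-B frame survives, because the typed class
`BalabanUVClass.Mem` (lit ✓`BalabanUVClass.lean`, the witness clauses `lower`∕`upper`∕`lf_nonneg`∕`lf_le`∕`large`, (41)∕(47) pp.266–267,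
(5) p.256, (71) p.273 of [Balaban1985UV3]) pins the large-field part `lf` only GLOBALLY (`lf ≤ e^{−cLF}·e^{c5|T|}`, `r ≤ e^{−cLF·|S|}·e^{c5|T|}`
at data with the plaquettes of `S` large) and never fibrewise or locally — LEAD-20520 w3 g22's answer to dismissal check (i) (17:36:19Z:
«NO CLAUSE PINS `lf` FIBREWISE OR LOCALLY»).  This file states that reading as KERNEL FACTS about the typed class, nothing more:

* §1 ★`mem_scale_add_bump` — at one level of one run: if `r ∈ Mem av prm` then `(1 − ε)·r + g ∈ Mem av prm′` for EVERY measurable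
  gauge-invariant bump `0 ≤ g` whose size at each datum fits the class's own large-field room scaled by `ε` (`g V ≤ ε·e^{−cLF}e^{c5|T|}`
  everywhere and `g V ≤ ε·e^{−cLF·|S|}e^{c5|T|}` whenever the plaquettes of `S` are `δL`-large in `V` — the SHAPE of the clauses `lf_le` and
  `large`, no locality of `g` whatsoever), where `prm′ := { prm with slack := prm.slack − log (1 − ε) }` (a `ClassParams.Weaker` move:
  only the slack grows, by `−log(1 − ε)`).  The witness is the old one with `lf′ := (1 − ε)·lf + g` (the `Witness.relax` pattern, clause by
  clause).  A product bump `A·𝔤(hol_{p₁}V)·𝔤(hol_{p₂}V)·s(V)` at torus distance `d` (dossier §2) is admitted verbatim.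
* §2 ★`memAtHeight_scale_add_bump` — the same through the height vocabulary `MemAtHeight F ℰ j prm r` of the frame (∃ run `K ≥ j`;
  `readAtLevel` is pointwise; the room hypotheses are asked on every run `K ≥ j`, read on run `K`'s lattice).
* §3 ★`marginal_mixedDiff_eq_zero` — the other half of dossier §3: O1's marginal `Σ_p c_p·f(hol_p ·)` has ZERO mixed second difference
  over the four configurations `U, V, W, Z` of O1's 4-point clause at bonds `b, b′` as soon as no plaquette has both `b` and `b′` on its
  boundary (so the output marginal `c′` «cannot absorb a product bump»); with ✓`plaqHol_congr` (the plaquette variable depends on the four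
  boundary bonds only).

WHAT THIS IS NOT.  Nothing here proves or refutes O1 `OneStepContractionRun` (any version), JEN∘ or COLLAR∘: the dossier's (I)
(a frame-inhabiting tower pair with slack) and (II) (co-area continuity of fibre integrals) stay pen and paper; the lemmas only certify
that the CLASS AS TYPED leaves the room the transplant uses, which is also the precise obstruction an (R-b) «lf-locality clause» would have
to add.  Nothing of Bałaban's is asserted (the class is a PREDICATE; these are closure properties of the predicate).  20520
`FluctuationComparisonRegPrIntL` ∕ `YM3TorusSU2` NOT proved; R3 = SU(2) YM₃ on T³ — NOT d = 4, NOT infinite volume, NOT a mass gap, NOT Clay.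
-/

noncomputable section

open MeasureTheory
open Literature.MathematicalPhysics.QuantumFieldTheory
open Literature.MathematicalPhysics.QuantumFieldTheory.Balaban1983to89
open Literature.MathematicalPhysics.QuantumFieldTheory.Balaban1983to89.T3ContinuumYM3Torus
open Literature.MathematicalPhysics.QuantumFieldTheory.Balaban1983to89.T3LevelShift
open Literature.MathematicalPhysics.QuantumFieldTheory.Balaban1983to89.BalabanUVClass

namespace Summit.QuantumFields.YangMills.Theorems.FluctuationComparisonRegPrIntLClassBumpRoom

/-! ## §1 One level of one run: the class is closed under «scale by `1 − ε`, add a bump inside the large-field room» -/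

section Level

variable {P : Params} {k : ℕ} {G : Type*} [GaugeGroup G] [MeasurableSpace G]
variable {av : (i : ℕ) → Averaging P i G} {prm : ClassParams} {r g : GaugeField P k G → ℝ} {ε : ℝ}

/-- ★ **lf-ROOM OF THE TYPED CLASS, ONE LEVEL** (D25-8 §2 «`Mem` at every level ✓» ∕ dismissal check (i) BY KERNEL): if `r` is in Bałaban's
class with parameters `prm`, then so is `(1 − ε)·r + g` — with the slack enlarged by `−log(1 − ε)` and nothing else changed — for every
measurable, gauge-invariant, non-negative bump `g` fitting the class's own large-field room scaled by `ε`: `g ≤ ε·e^{−cLF}·e^{c5|T^{(k)}|}`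
everywhere (the shape of `lf_le`) and `g(V) ≤ ε·e^{−cLF·|S|}·e^{c5|T^{(k)}|}` whenever all plaquettes of `S` are `δL`-large in `V` (the shape of
`large`).  No locality of `g` is required: the typed clauses (41)∕(47) (two-sided bound on the all-small set with a free additive `lf`), (5) and
(71) constrain the large-field part only globally.  Witness: the old background, domains, activities and constant, `lf′ := (1 − ε)·lf + g`.
[cite: Balaban1985UV3, (41)-(47) pp.266-267, (5) p.256, (71) p.273] -/
theorem mem_scale_add_bump (hr : Mem av prm r) (hε0 : 0 ≤ ε) (hε1 : ε < 1) (hg0 : ∀ V, 0 ≤ g V) (hgm : Measurable g)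
    (hgi : GaugeField.GaugeInvariant g)
    (hroom : ∀ V, g V ≤ ε * (Real.exp (-prm.cLF) * Real.exp (prm.c5 * Fintype.card (Site P k))))
    (hroomS : ∀ (V : GaugeField P k G) (S : Finset (Plaq P k)), (∀ p ∈ S, prm.δL ≤ dist1 (GaugeField.plaqHol V p)) →
      g V ≤ ε * (Real.exp (-(prm.cLF * S.card)) * Real.exp (prm.c5 * Fintype.card (Site P k)))) :
    Mem av { prm with slack := prm.slack - Real.log (1 - ε) } (fun V => (1 - ε) * r V + g V) := by
  obtain ⟨W⟩ := hr
  have h1 : 0 < 1 - ε := by linarith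
  have hlog : Real.log (1 - ε) ≤ 0 := Real.log_nonpos (by linarith) (by linarith)
  exact ⟨{
    bg := W.bg
    nDom := W.nDom
    supp := W.supp
    foot := W.foot
    len := W.len
    wt := W.wt
    act := W.act
    cst := W.cst
    lf := fun V => (1 - ε) * W.lf V + g V
    nonneg := fun V => add_nonneg (mul_nonneg h1.le (W.nonneg V)) (hg0 V)
    measurable := (W.measurable.const_mul _).add hgm
    gaugeInvariant := fun u U => by
      show (1 - ε) * r (GaugeField.gaugeAct u U) + g (GaugeField.gaugeAct u U) = (1 - ε) * r U + g U
      rw [W.gaugeInvariant u U, hgi u U]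
    isBackground := W.isBackground
    foot_nonempty := W.foot_nonempty
    supp_foot := W.supp_foot
    len_nonneg := W.len_nonneg
    wt_nonneg := W.wt_nonneg
    diam_foot := W.diam_foot
    act_local := W.act_local
    act_gaugeInvariant := W.act_gaugeInvariant
    act_bound := W.act_bound
    cover := W.cover
    cst_abs_le := W.cst_abs_le
    lower := fun V hV => by
      have hl := W.lower V hV
      show Real.exp (-(prm.β * wilsonAction4 (W.bg V)) + (∑ X, W.act X (W.bg V)) + W.cst - (prm.slack - Real.log (1 - ε))) ≤
        (1 - ε) * r V + g V
      rw [show -(prm.β * wilsonAction4 (W.bg V)) + (∑ X, W.act X (W.bg V)) + W.cst - (prm.slack - Real.log (1 - ε)) =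
          (-(prm.β * wilsonAction4 (W.bg V)) + (∑ X, W.act X (W.bg V)) + W.cst - prm.slack) + Real.log (1 - ε) by ring,
        Real.exp_add, Real.exp_log h1]
      nlinarith [hg0 V, hl, h1.le]
    upper := fun V hV => by
      have hu := W.upper V hV
      show (1 - ε) * r V + g V ≤
        Real.exp (-(prm.β * wilsonAction4 (W.bg V)) + (∑ X, W.act X (W.bg V)) + W.cst + (prm.slack - Real.log (1 - ε))) +
          ((1 - ε) * W.lf V + g V)
      have hexp : Real.exp (-(prm.β * wilsonAction4 (W.bg V)) + (∑ X, W.act X (W.bg V)) + W.cst + prm.slack) ≤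
          Real.exp (-(prm.β * wilsonAction4 (W.bg V)) + (∑ X, W.act X (W.bg V)) + W.cst + (prm.slack - Real.log (1 - ε))) :=
        Real.exp_le_exp.mpr (by linarith)
      have hpos := Real.exp_pos (-(prm.β * wilsonAction4 (W.bg V)) + (∑ X, W.act X (W.bg V)) + W.cst + prm.slack)
      nlinarith [hu, hexp, hpos, h1.le, hε0]
    lf_nonneg := fun V => add_nonneg (mul_nonneg h1.le (W.lf_nonneg V)) (hg0 V)
    lf_le := fun V => by
      have hl := W.lf_le V
      have hg := hroom V
      show (1 - ε) * W.lf V + g V ≤ Real.exp (-prm.cLF) * Real.exp (prm.c5 * Fintype.card (Site P k))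
      nlinarith [hl, hg, h1.le, Real.exp_nonneg (-prm.cLF), Real.exp_nonneg (prm.c5 * Fintype.card (Site P k)),
        mul_nonneg (Real.exp_nonneg (-prm.cLF)) (Real.exp_nonneg (prm.c5 * Fintype.card (Site P k)))]
    large := fun V S hS => by
      have hl := W.large V S hS
      have hg := hroomS V S hS
      show (1 - ε) * r V + g V ≤ Real.exp (-(prm.cLF * S.card)) * Real.exp (prm.c5 * Fintype.card (Site P k))
      nlinarith [hl, hg, h1.le,
        mul_nonneg (Real.exp_nonneg (-(prm.cLF * S.card))) (Real.exp_nonneg (prm.c5 * Fintype.card (Site P k)))] }⟩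

/-- The move `slack ↦ slack − log(1 − ε)` of ★`mem_scale_add_bump` is a `ClassParams.Weaker` move (only the slack grows).
[cite: Balaban1985UV3, (5) pp.256-257] -/
theorem weaker_slack_sub_log (prm : ClassParams) (hε0 : 0 ≤ ε) (hε1 : ε < 1) :
    prm.Weaker { prm with slack := prm.slack - Real.log (1 - ε) } := by
  have hlog : Real.log (1 - ε) ≤ 0 := Real.log_nonpos (by linarith) (by linarith)
  exact ⟨le_rfl, rfl, le_rfl, rfl, rfl, le_rfl, le_rfl, le_rfl, by show prm.slack ≤ prm.slack - Real.log (1 - ε); linarith,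
    le_rfl, le_rfl⟩

end Level

/-! ## §2 The same through the height vocabulary of the frame (`MemAtHeight`) -/

section Height

variable (F : T3Family) {G : Type*} [GaugeGroup G] [MeasurableSpace G]
variable {ℰ : LoopAverage G} {j : ℕ} {prm : ClassParams} {r g : GaugeField (F.P j) 0 G → ℝ} {ε : ℝ}

omit [MeasurableSpace G] in
/-- Gauge invariance is preserved by reading a height-`j` function on run `K` (`fieldShift` intertwines the gauge actions,
✓`T3LevelShift.fieldShift_gaugeAct`). [cite: Balaban1985Averaging, (8) p.19, (12) p.19] -/
theorem gaugeInvariant_readAtLevel {K : ℕ} (hK : j ≤ K) (hgi : GaugeField.GaugeInvariant g) :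
    GaugeField.GaugeInvariant (readAtLevel F hK g) := by
  intro u W
  rw [readAtLevel_apply, readAtLevel_apply]
  exact (congrArg g (fieldShift_gaugeAct (heightShift_eq F hK) u W)).trans (hgi _ _)

/-- ★ **lf-ROOM OF THE TYPED CLASS, AT A HEIGHT** (the frame's `MemAtHeight F ℰ j (prm j) (ρ j)` clause, D25-8 §2 ∕ check (i) BY KERNEL):
if `r` is a height-`j` member with parameters `prm` then `(1 − ε)·r + g` is a height-`j` member with the slack enlarged by `−log(1 − ε)`,
for every measurable gauge-invariant bump `0 ≤ g` that fits, on every run `K ≥ j` (read on run `K`'s level-`(K − j)` lattice through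
`fieldShift`), the class's own large-field room scaled by `ε` — `lf_le`-shape everywhere, `large`-shape at data with `δL`-large plaquettes.
No locality of `g` is asked. [cite: Balaban1985UV3, (41)-(47) pp.266-267, (5) p.256, (71) p.273] -/
theorem memAtHeight_scale_add_bump (hr : MemAtHeight F ℰ j prm r) (hε0 : 0 ≤ ε) (hε1 : ε < 1) (hg0 : ∀ V, 0 ≤ g V)
    (hgm : Measurable g) (hgi : GaugeField.GaugeInvariant g)
    (hroom : ∀ K, j ≤ K → ∀ V, g V ≤ ε * (Real.exp (-prm.cLF) * Real.exp (prm.c5 * Fintype.card (Site (F.P K) (K - j)))))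
    (hroomS : ∀ (K : ℕ) (hK : j ≤ K) (W : GaugeField (F.P K) (K - j) G) (S : Finset (Plaq (F.P K) (K - j))),
      (∀ p ∈ S, prm.δL ≤ dist1 (GaugeField.plaqHol W p)) →
        g (fieldShift (heightShift_eq F hK) W) ≤
          ε * (Real.exp (-(prm.cLF * S.card)) * Real.exp (prm.c5 * Fintype.card (Site (F.P K) (K - j))))) :
    MemAtHeight F ℰ j { prm with slack := prm.slack - Real.log (1 - ε) } (fun V => (1 - ε) * r V + g V) := by
  obtain ⟨K, hK, hm⟩ := hr
  refine ⟨K, hK, ?_⟩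
  have key := mem_scale_add_bump (g := readAtLevel F hK g) hm hε0 hε1 (fun W => hg0 _) (measurable_readAtLevel F hK hgm)
    (gaugeInvariant_readAtLevel F hK hgi) (fun W => hroom K hK _) (fun W S hS => hroomS K hK W S hS)
  exact key

end Height

/-! ## §3 The marginal has zero mixed second difference at bonds that share no plaquette -/

section Marginal

variable {P : Params} {j : ℕ} {G : Type*} [GaugeGroup G]

/-- The plaquette variable `U(∂p)` depends on the gauge field only through the four boundary bonds of `p`. [cite: Balaban1985Averaging, (9) p.19] -/
theorem plaqHol_congr {U V : GaugeField P j G} {p : Plaq P j} (h₁ : U ⟨p.src, p.μ⟩ = V ⟨p.src, p.μ⟩)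
    (h₂ : U ⟨p.src.shift p.μ, p.ν⟩ = V ⟨p.src.shift p.μ, p.ν⟩) (h₃ : U ⟨p.src.shift p.ν, p.μ⟩ = V ⟨p.src.shift p.ν, p.μ⟩)
    (h₄ : U ⟨p.src, p.ν⟩ = V ⟨p.src, p.ν⟩) : GaugeField.plaqHol U p = GaugeField.plaqHol V p := by
  simp only [GaugeField.plaqHol, h₁, h₂, h₃, h₄]

/-- If two gauge fields agree off a bond `b` that is not on the boundary of `p`, their plaquette variables at `p` agree.
[cite: Balaban1985Averaging, (9) p.19] -/
theorem plaqHol_eq_of_eq_off_bond {U V : GaugeField P j G} {b : PBond P j} {p : Plaq P j} (hUV : ∀ e, e ≠ b → U e = V e)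
    (hb : b ≠ ⟨p.src, p.μ⟩ ∧ b ≠ ⟨p.src.shift p.μ, p.ν⟩ ∧ b ≠ ⟨p.src.shift p.ν, p.μ⟩ ∧ b ≠ ⟨p.src, p.ν⟩) :
    GaugeField.plaqHol U p = GaugeField.plaqHol V p :=
  plaqHol_congr (hUV _ (Ne.symm hb.1)) (hUV _ (Ne.symm hb.2.1)) (hUV _ (Ne.symm hb.2.2.1)) (hUV _ (Ne.symm hb.2.2.2))

/-- ★ **THE MARGINAL CANNOT ABSORB A PRODUCT BUMP** (D25-8 §3, the `c′`-half): over the four configurations `U, V, W, Z` of O1's 4-point clause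
(`V` = `U` changed at `b`, `W` = `U` changed at `b′`, `Z` = both: `U = V` off `b`, `U = W` off `b′`, `V = Z` off `b′`, `W = Z` off `b`), the
marginal `Σ_p c_p·f(U(∂p))` has ZERO mixed second difference as soon as no plaquette has both `b` and `b′` among its four boundary bonds —
for every `c` and every `f` (in O1, `f = 1 − Re tr` times `L^j∕γ`): each plaquette misses `b` (then `U(∂p) = V(∂p)`, `W(∂p) = Z(∂p)`) or misses
`b′` (then `U(∂p) = W(∂p)`, `V(∂p) = Z(∂p)`). [cite: Balaban1985UV3, (41)-(47) pp.266-267] -/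
theorem marginal_mixedDiff_eq_zero [Fintype (Plaq P j)] (c : Plaq P j → ℝ) (f : G → ℝ) (b b' : PBond P j)
    (U V W Z : GaugeField P j G)
    (hfar : ∀ p : Plaq P j,
      (b ≠ ⟨p.src, p.μ⟩ ∧ b ≠ ⟨p.src.shift p.μ, p.ν⟩ ∧ b ≠ ⟨p.src.shift p.ν, p.μ⟩ ∧ b ≠ ⟨p.src, p.ν⟩) ∨
        (b' ≠ ⟨p.src, p.μ⟩ ∧ b' ≠ ⟨p.src.shift p.μ, p.ν⟩ ∧ b' ≠ ⟨p.src.shift p.ν, p.μ⟩ ∧ b' ≠ ⟨p.src, p.ν⟩))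
    (e₁ : ∀ e, e ≠ b → U e = V e) (e₂ : ∀ e, e ≠ b' → U e = W e) (e₃ : ∀ e, e ≠ b' → V e = Z e)
    (e₄ : ∀ e, e ≠ b → W e = Z e) :
    (∑ p, c p * f (GaugeField.plaqHol U p)) - (∑ p, c p * f (GaugeField.plaqHol V p)) -
        ((∑ p, c p * f (GaugeField.plaqHol W p)) - (∑ p, c p * f (GaugeField.plaqHol Z p))) = 0 := by
  rw [← Finset.sum_sub_distrib, ← Finset.sum_sub_distrib, ← Finset.sum_sub_distrib]
  refine Finset.sum_eq_zero fun p _ => ?_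
  rcases hfar p with hb | hb'
  · rw [plaqHol_eq_of_eq_off_bond e₁ hb, plaqHol_eq_of_eq_off_bond e₄ hb]
    ring
  · rw [plaqHol_eq_of_eq_off_bond e₂ hb', plaqHol_eq_of_eq_off_bond e₃ hb']
    ring

end Marginal

end Summit.QuantumFields.YangMills.Theorems.FluctuationComparisonRegPrIntLClassBumpRoom

end
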